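import Summits.Ventures.HodgeRepro2.T5SU11JacobiWeightRate

/-!
# The lower bound `1 + c' s ≤ Φ_λ(s)` OUTSIDE `0 ≤ λ ≤ 2`, and the sharp first correction of the transform there:
`(k − 2)((k − 2) m̂_k(λ)/(2π) − 1) → c' = λ(λ − 2)/2` — hence for EVERY real `λ`

`T5SU11JacobiPhaseLawRateOutside` gives `1 ≤ Φ_λ(s) ≤ e^{c' s}` for `λ ≥ 2`, `c' = λ(λ − 2)/2`. Feeding `u ≥ 1` back
into the integrated radial equation `sinh 2t · u'(t) = λ(λ − 2) ∫_0^t sinh 2τ · u(τ) dτ` gives the matching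
lower bound on the derivative, **`u'(t) ≥ c' tanh t`** (`deriv_sph_hyp_ge_of_two_le`), so `u − c' log cosh t` is
monotone on `[0, ∞)` and, in the phase `s = log cosh t`,

  **`1 + c' s ≤ Φ_λ(s) ≤ e^{c' s}`**   (`one_add_mul_le_sphPhase_of_two_le`; for `λ ≤ 0` by `Φ_λ = Φ_{2−λ}`,
  `one_add_mul_le_sphPhase_of_nonpos`):

the slope `c'` at `s = 0` is SHARP on both sides (`u''(0) = λ(λ − 2)/2 = c'`). Consequences, with `r = k − 2 > c'`:

* the moment integrals pinned, `n!/r^{n+1} + c' (n+1)!/r^{n+2} ≤ ∫_0^∞ sⁿ e^{−rs} Φ_λ(s) ds ≤ n!/(r − c')^{n+1}`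
  (`le_moment_phase_of_two_le`, `moment_phase_le_of_two_le`, after the integrability
  `integrableOn_pow_mul_exp_mul_sphPhase_of_two_le`);
* **`1 + c'/r ≤ (k − 2) m̂_k(λ)/(2π) ≤ r/(r − c')`** (`one_add_le_weight_ratio_of_two_le`, with
  `T5SU11JacobiWeightRate.weight_ratio_le_of_two_le`), hence the sharp first correction of the transform outside
  the Jensen range, **`(k − 2)((k − 2) m̂_k(λ)/(2π) − 1) → c'`** (`tendsto_mul_weight_ratio_sub_one_of_two_le`,
  `_of_nonpos`) — and, with `T5SU11JacobiWeightRate.tendsto_mul_one_sub_weight_ratio` on `0 ≤ λ ≤ 2`, the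
  UNIFORM statement **`(k − 2)((k − 2) m̂_k(λ)/(2π) − 1) → λ(λ − 2)/2` for every real `λ`**
  (`tendsto_mul_weight_ratio_sub_one`): `m̂_k(λ) = (2π/(k − 2))(1 + λ(λ − 2)/(2(k − 2)) + o(1/k))`.

The mean phase outside the Jensen range is `T5SU11JacobiMeanPhaseOutside`. Nothing is claimed about (N).

Blind lane: Mathlib + the HodgeRepro2 prefix only; no sorry; axioms ⊆ {propext, Classical.choice,
Quot.sound}.
-/

namespace Summit.Ventures.HodgeRepro2.T5SU11JacobiPhaseLowerOutside

open MeasureTheory MeasureTheory.Measure Metric Set Filter Topology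
open T5SU11Unimodular T5SU11Fibration T5SU11Cartan T5SU11OneParameter T5SU11CartanProjection T5HaarCircle
  T5BergmanCoefficient T5SU11FibrationHaar T5SU11SphericalFunction T5SU11SphericalSymmetry
  T5SU11SphericalBounds T5SU11SphericalContinuous T5SU11SphericalDeriv T5SU11SphericalLipschitz
  T5SU11JacobiLaplacePhase T5SU11PhaseLawLintegral T5SU11JacobiWeightDerivAll T5SU11JacobiPhaseTailGroup
  T5SU11JacobiPhaseLipschitz T5SU11JacobiPhaseLawRate T5SU11JacobiMeanPhaseRate T5SU11JacobiPhaseSecondOrder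
  T5SU11JacobiPhaseLawRateOutside T5SU11JacobiWeightRate
open scoped Real

/-- `1/(k − 2) → 0`. -/
theorem tendsto_one_div_sub_two : Tendsto (fun k : ℝ => 1 / (k - 2)) atTop (𝓝 0) :=
  (tendsto_atTop_add_const_right atTop (-2) tendsto_id).const_div_atTop 1 |>.congr'
    (Filter.Eventually.of_forall fun k => by simp only [id, sub_eq_add_neg])

section measure

variable [MeasurableSpace Circle] [BorelSpace Circle]

/-! ### The lower bound on the derivative and in the phase -/

/-- **The integral of the radial equation from below** for `λ ≥ 2`, `t ≥ 0`:
`(cosh 2t − 1)/2 ≤ ∫_0^t sinh 2τ · u(τ) dτ` (from `u ≥ 1`). -/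
theorem integral_sinh_mul_sph_hyp_ge_of_two_le {lam : ℝ} (h2 : 2 ≤ lam) {t : ℝ} (ht : 0 ≤ t) :
    (Real.cosh (2 * t) - 1) / 2 ≤ ∫ s in (0 : ℝ)..t, Real.sinh (2 * s) * sph lam (hyp s) := by
  rw [← integral_sinh_two_mul]
  refine intervalIntegral.integral_mono_on ht (Real.continuous_sinh.comp (continuous_const.mul continuous_id)
    |>.intervalIntegrable _ _) ((continuous_sinh_mul_sph_hyp lam).intervalIntegrable _ _) fun s hs => ?_
  have hsh : 0 ≤ Real.sinh (2 * s) := Real.sinh_nonneg_iff.mpr (by linarith [hs.1])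
  exact le_mul_of_one_le_right hsh (one_le_sph_hyp_of_two_le h2 s)

/-- **`c' tanh t ≤ u'(t)`** for `λ ≥ 2`, `t > 0`, `c' = λ(λ − 2)/2`. -/
theorem deriv_sph_hyp_ge_of_two_le {lam : ℝ} (h2 : 2 ≤ lam) {t : ℝ} (ht : 0 < t) :
    lam * (lam - 2) / 2 * Real.tanh t ≤ deriv (fun t => sph lam (hyp t)) t := by
  have hs : 0 < Real.sinh (2 * t) := Real.sinh_pos_iff.mpr (by linarith)
  have h := sinh_mul_deriv_eq_integral lam t
  have hI := integral_sinh_mul_sph_hyp_ge_of_two_le h2 ht.le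
  have hl : 0 ≤ lam * (lam - 2) := mul_nonneg (by linarith) (by linarith)
  have h1 : lam * (lam - 2) * ((Real.cosh (2 * t) - 1) / 2)
      ≤ Real.sinh (2 * t) * deriv (fun t => sph lam (hyp t)) t := by
    rw [h]
    exact mul_le_mul_of_nonneg_left hI hl
  rw [cosh_two_mul_sub_one] at h1
  have h2' : Real.sinh (2 * t) * (lam * (lam - 2) / 2 * Real.tanh t)
      ≤ Real.sinh (2 * t) * deriv (fun t => sph lam (hyp t)) t := by
    refine le_trans (le_of_eq ?_) h1
    ring
  exact le_of_mul_le_mul_left h2' hs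

/-- **`u − c' log cosh t` is monotone on `[0, ∞)`** for `λ ≥ 2`. -/
theorem monotoneOn_sph_hyp_sub_log_cosh {lam : ℝ} (h2 : 2 ≤ lam) :
    MonotoneOn (fun t : ℝ => sph lam (hyp t) - lam * (lam - 2) / 2 * Real.log (Real.cosh t)) (Ici 0) := by
  have hdiff : Differentiable ℝ fun t : ℝ => sph lam (hyp t) - lam * (lam - 2) / 2 * Real.log (Real.cosh t) :=
    (differentiable_sph_hyp lam).sub (differentiable_log_cosh.const_mul _)
  refine monotoneOn_of_deriv_nonneg (convex_Ici 0) hdiff.continuous.continuousOn hdiff.differentiableOn ?_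
  intro x hx
  rw [interior_Ici] at hx
  have hd : HasDerivAt (fun t : ℝ => sph lam (hyp t) - lam * (lam - 2) / 2 * Real.log (Real.cosh t))
      (deriv (fun t => sph lam (hyp t)) x - lam * (lam - 2) / 2 * Real.tanh x) x :=
    (differentiable_sph_hyp lam x).hasDerivAt.sub ((hasDerivAt_log_cosh x).const_mul _)
  rw [hd.deriv, sub_nonneg]
  exact deriv_sph_hyp_ge_of_two_le h2 hx

/-- **`1 + c' s ≤ Φ_λ(s)`** for `λ ≥ 2`, `s ≥ 0`, `c' = λ(λ − 2)/2`: the slope `c'` at `s = 0` is sharp from below. -/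
theorem one_add_mul_le_sphPhase_of_two_le {lam : ℝ} (h2 : 2 ≤ lam) {s : ℝ} (hs : 0 ≤ s) :
    1 + lam * (lam - 2) / 2 * s ≤ sphPhase lam s := by
  have h := monotoneOn_sph_hyp_sub_log_cosh h2 (mem_Ici.mpr (le_refl (0 : ℝ)))
    (mem_Ici.mpr (cartanOfPhase_nonneg' s)) (cartanOfPhase_nonneg' s)
  simp only [T5SU11OneParameter.hyp_zero, sph_one, Real.cosh_zero, Real.log_one, mul_zero, sub_zero,
    log_cosh_cartanOfPhase hs] at h
  unfold sphPhase
  linarith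

/-- **`1 + c' s ≤ Φ_λ(s)`** for `λ ≤ 0`, `s ≥ 0` (by `Φ_λ = Φ_{2−λ}` and `(2 − λ)(−λ) = λ(λ − 2)`). -/
theorem one_add_mul_le_sphPhase_of_nonpos {lam : ℝ} (h0 : lam ≤ 0) {s : ℝ} (hs : 0 ≤ s) :
    1 + lam * (lam - 2) / 2 * s ≤ sphPhase lam s := by
  rw [sphPhase_two_sub]
  have := one_add_mul_le_sphPhase_of_two_le (lam := 2 - lam) (by linarith) hs
  rwa [show (2 - lam) * (2 - lam - 2) / 2 = lam * (lam - 2) / 2 by ring] at this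

/-! ### The moment integrals pinned outside the Jensen range -/

/-- `sⁿ e^{−(k−2)s} Φ_λ(s)` is integrable on `(0, ∞)` for `λ ≥ 2`, `k − 2 > c'` (dominated by `sⁿ e^{−(k−2−c')s}`). -/
theorem integrableOn_pow_mul_exp_mul_sphPhase_of_two_le (n : ℕ) {k lam : ℝ} (h2 : 2 ≤ lam)
    (hk : lam * (lam - 2) / 2 < k - 2) :
    IntegrableOn (fun s : ℝ => s ^ n * Real.exp (-((k - 2) * s)) * sphPhase lam s) (Ioi 0) := by
  set c : ℝ := lam * (lam - 2) / 2 with hc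
  have hc0 : 0 ≤ c := by rw [hc]; exact div_nonneg (mul_nonneg (by linarith) (by linarith)) (by norm_num)
  have hr : 0 < k - 2 - c := by linarith
  refine (integrableOn_pow_mul_exp_neg_mul_Ioi' n hr).mono' ?_ ?_
  · exact (((continuous_id.pow n).mul (Real.continuous_exp.comp
      (continuous_const.mul continuous_id).neg)).mul (continuous_sphPhase lam)).aestronglyMeasurable
  · filter_upwards [ae_restrict_mem measurableSet_Ioi] with s hs
    have hs0 : 0 ≤ s := le_of_lt hs
    rw [Real.norm_of_nonneg (mul_nonneg (mul_nonneg (pow_nonneg hs0 n) (Real.exp_pos _).le)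
      (sphPhase_pos lam s).le)]
    calc s ^ n * Real.exp (-((k - 2) * s)) * sphPhase lam s
        ≤ s ^ n * Real.exp (-((k - 2) * s)) * Real.exp (c * s) :=
          mul_le_mul_of_nonneg_left (sphPhase_le_exp_of_two_le h2 hs0)
            (mul_nonneg (pow_nonneg hs0 n) (Real.exp_pos _).le)
      _ = s ^ n * Real.exp (-((k - 2 - c) * s)) := by
          rw [mul_assoc, ← Real.exp_add]
          congr 2
          ring

/-- **The moment integrals from below** for `λ ≥ 2`, `k − 2 > c'`:
`n!/(k − 2)^{n+1} + c' (n + 1)!/(k − 2)^{n+2} ≤ ∫_0^∞ sⁿ e^{−(k−2)s} Φ_λ(s) ds`. -/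
theorem le_moment_phase_of_two_le (n : ℕ) {k lam : ℝ} (h2 : 2 ≤ lam) (hk : lam * (lam - 2) / 2 < k - 2) :
    (n.factorial : ℝ) / (k - 2) ^ (n + 1) + lam * (lam - 2) / 2 * ((n + 1).factorial : ℝ) / (k - 2) ^ (n + 2)
      ≤ ∫ s in Ioi (0 : ℝ), s ^ n * Real.exp (-((k - 2) * s)) * sphPhase lam s := by
  set c : ℝ := lam * (lam - 2) / 2 with hc
  have hc0 : 0 ≤ c := by rw [hc]; exact div_nonneg (mul_nonneg (by linarith) (by linarith)) (by norm_num)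
  have hr : 0 < k - 2 := by linarith
  have hval : ∫ s in Ioi (0 : ℝ), s ^ n * Real.exp (-((k - 2) * s)) * (1 - (-c) * s)
      = (n.factorial : ℝ) / (k - 2) ^ (n + 1) + c * ((n + 1).factorial : ℝ) / (k - 2) ^ (n + 2) := by
    have e : ∀ s : ℝ, s ^ n * Real.exp (-((k - 2) * s)) * (1 - (-c) * s)
        = s ^ n * Real.exp (-((k - 2) * s)) + c * (s ^ (n + 1) * Real.exp (-((k - 2) * s))) := fun s => by
      rw [pow_succ]
      ring
    simp_rw [e]
    rw [integral_add (integrableOn_pow_mul_exp_neg_mul_Ioi' n hr)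
      ((integrableOn_pow_mul_exp_neg_mul_Ioi' (n + 1) hr).const_mul c), integral_const_mul,
      integral_pow_mul_exp_neg_mul_Ioi n hr, integral_pow_mul_exp_neg_mul_Ioi (n + 1) hr]
    ring
  rw [← hval]
  refine setIntegral_mono_on (integrableOn_pow_mul_exp_neg_mul_one_sub_Ioi n hr (-c))
    (integrableOn_pow_mul_exp_mul_sphPhase_of_two_le n h2 hk) measurableSet_Ioi fun s hs => ?_
  have hs0 : 0 ≤ s := le_of_lt hs
  have := one_add_mul_le_sphPhase_of_two_le h2 hs0
  rw [← hc] at this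
  refine mul_le_mul_of_nonneg_left ?_ (mul_nonneg (pow_nonneg hs0 n) (Real.exp_pos _).le)
  linarith

/-- **The moment integrals from above** for `λ ≥ 2`, `k − 2 > c'`:
`∫_0^∞ sⁿ e^{−(k−2)s} Φ_λ(s) ds ≤ n!/(k − 2 − c')^{n+1}`. -/
theorem moment_phase_le_of_two_le (n : ℕ) {k lam : ℝ} (h2 : 2 ≤ lam) (hk : lam * (lam - 2) / 2 < k - 2) :
    ∫ s in Ioi (0 : ℝ), s ^ n * Real.exp (-((k - 2) * s)) * sphPhase lam s
      ≤ (n.factorial : ℝ) / (k - 2 - lam * (lam - 2) / 2) ^ (n + 1) := by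
  set c : ℝ := lam * (lam - 2) / 2 with hc
  have hr : 0 < k - 2 - c := by linarith
  rw [← integral_pow_mul_exp_neg_mul_Ioi n hr]
  refine setIntegral_mono_on (integrableOn_pow_mul_exp_mul_sphPhase_of_two_le n h2 hk)
    (integrableOn_pow_mul_exp_neg_mul_Ioi' n hr) measurableSet_Ioi fun s hs => ?_
  have hs0 : 0 ≤ s := le_of_lt hs
  calc s ^ n * Real.exp (-((k - 2) * s)) * sphPhase lam s
      ≤ s ^ n * Real.exp (-((k - 2) * s)) * Real.exp (c * s) :=
        mul_le_mul_of_nonneg_left (sphPhase_le_exp_of_two_le h2 hs0)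
          (mul_nonneg (pow_nonneg hs0 n) (Real.exp_pos _).le)
    _ = s ^ n * Real.exp (-((k - 2 - c) * s)) := by
        rw [mul_assoc, ← Real.exp_add]
        congr 2
        ring

/-! ### The transform: the sharp first correction outside the Jensen range -/

/-- **`1 + c'/(k − 2) ≤ (k − 2) m̂_k(λ)/(2π)`** for `λ ≥ 2`, `k − 2 > c'`. -/
theorem one_add_le_weight_ratio_of_two_le {k lam : ℝ} (h2 : 2 ≤ lam) (hk : lam * (lam - 2) / 2 < k - 2) :
    1 + lam * (lam - 2) / 2 / (k - 2)
      ≤ (k - 2) * (∫ g, (1 - ‖orbit g‖ ^ 2) ^ (k / 2) * sph lam g ∂(nu haarCircle)) / (2 * π) := by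
  have hc0 : 0 ≤ lam * (lam - 2) / 2 := div_nonneg (mul_nonneg (by linarith) (by linarith)) (by norm_num)
  have hr : 0 < k - 2 := by linarith
  have hk' : lam < k := by nlinarith
  rw [jacobi_eq_laplace_phase (by linarith) hk' (by linarith),
    show (k - 2) * (2 * π * ∫ s in Ioi (0 : ℝ), Real.exp (-((k - 2) * s)) * sphPhase lam s) / (2 * π)
      = (k - 2) * ∫ s in Ioi (0 : ℝ), Real.exp (-((k - 2) * s)) * sphPhase lam s by
        field_simp]
  have h := le_moment_phase_of_two_le 0 h2 hk
  simp only [pow_zero, one_mul, Nat.factorial_zero, Nat.cast_one, zero_add, pow_one, Nat.factorial_one,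
    mul_one] at h
  calc 1 + lam * (lam - 2) / 2 / (k - 2)
      = (k - 2) * (1 / (k - 2) + lam * (lam - 2) / 2 / (k - 2) ^ 2) := by field_simp
    _ ≤ (k - 2) * ∫ s in Ioi (0 : ℝ), Real.exp (-((k - 2) * s)) * sphPhase lam s :=
        mul_le_mul_of_nonneg_left h hr.le

/-- **`1 + c'/(k − 2) ≤ (k − 2) m̂_k(λ)/(2π)`** for `λ ≤ 0`, `k − 2 > c'` (by `φ_λ = φ_{2−λ}`). -/
theorem one_add_le_weight_ratio_of_nonpos {k lam : ℝ} (h0 : lam ≤ 0) (hk : lam * (lam - 2) / 2 < k - 2) :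
    1 + lam * (lam - 2) / 2 / (k - 2)
      ≤ (k - 2) * (∫ g, (1 - ‖orbit g‖ ^ 2) ^ (k / 2) * sph lam g ∂(nu haarCircle)) / (2 * π) := by
  have e : (2 - lam) * (2 - lam - 2) / 2 = lam * (lam - 2) / 2 := by ring
  have h := one_add_le_weight_ratio_of_two_le (lam := 2 - lam) (k := k) (by linarith) (by rw [e]; exact hk)
  rw [e] at h
  simp_rw [← sph_two_sub lam] at h
  exact h

/-- **The sharp first correction of the transform outside the Jensen range**: for `λ ≥ 2`,
`(k − 2)((k − 2) m̂_k(λ)/(2π) − 1) → c' = λ(λ − 2)/2` as `k → ∞`. -/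
theorem tendsto_mul_weight_ratio_sub_one_of_two_le {lam : ℝ} (h2 : 2 ≤ lam) :
    Tendsto (fun k : ℝ => (k - 2)
        * ((k - 2) * (∫ g, (1 - ‖orbit g‖ ^ 2) ^ (k / 2) * sph lam g ∂(nu haarCircle)) / (2 * π) - 1))
      atTop (𝓝 (lam * (lam - 2) / 2)) := by
  set c : ℝ := lam * (lam - 2) / 2 with hc
  have hc0 : 0 ≤ c := by rw [hc]; exact div_nonneg (mul_nonneg (by linarith) (by linarith)) (by norm_num)
  have hε := tendsto_one_div_sub_two
  have hU : Tendsto (fun k : ℝ => c / (1 - c * (1 / (k - 2)))) atTop (𝓝 (c / (1 - c * 0))) :=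
    tendsto_const_nhds.div (tendsto_const_nhds.sub (hε.const_mul c)) (by norm_num)
  rw [mul_zero, sub_zero, div_one] at hU
  refine tendsto_of_tendsto_of_tendsto_of_le_of_le' tendsto_const_nhds hU ?_ ?_
  · filter_upwards [eventually_gt_atTop (c + 2)] with k hk
    have hr : 0 < k - 2 := by linarith
    have h := one_add_le_weight_ratio_of_two_le h2 (by rw [← hc]; linarith)
    rw [← hc] at h
    calc c = (k - 2) * (1 + c / (k - 2) - 1) := by field_simp; ring
      _ ≤ (k - 2) * ((k - 2) * (∫ g, (1 - ‖orbit g‖ ^ 2) ^ (k / 2) * sph lam g ∂(nu haarCircle)) / (2 * π) - 1) :=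
          mul_le_mul_of_nonneg_left (by linarith) hr.le
  · filter_upwards [eventually_gt_atTop (c + 2)] with k hk
    have hr : 0 < k - 2 := by linarith
    have hrc : 0 < k - 2 - c := by linarith
    have h := weight_ratio_le_of_two_le h2 (by rw [← hc]; linarith)
    rw [← hc] at h
    calc (k - 2) * ((k - 2) * (∫ g, (1 - ‖orbit g‖ ^ 2) ^ (k / 2) * sph lam g ∂(nu haarCircle)) / (2 * π) - 1)
        ≤ (k - 2) * ((k - 2) / (k - 2 - c) - 1) := mul_le_mul_of_nonneg_left (by linarith) hr.le
      _ = c / (1 - c * (1 / (k - 2))) := by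
          have h3 : 1 - c * (1 / (k - 2)) ≠ 0 := by
            have : c * (1 / (k - 2)) < 1 := by
              rw [mul_one_div, div_lt_one hr]
              linarith
            linarith
          field_simp
          ring

/-- **The sharp first correction of the transform for `λ ≤ 0`**: `(k − 2)((k − 2) m̂_k(λ)/(2π) − 1) → c'`. -/
theorem tendsto_mul_weight_ratio_sub_one_of_nonpos {lam : ℝ} (h0 : lam ≤ 0) :
    Tendsto (fun k : ℝ => (k - 2)
        * ((k - 2) * (∫ g, (1 - ‖orbit g‖ ^ 2) ^ (k / 2) * sph lam g ∂(nu haarCircle)) / (2 * π) - 1))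
      atTop (𝓝 (lam * (lam - 2) / 2)) := by
  have e : (2 - lam) * (2 - lam - 2) / 2 = lam * (lam - 2) / 2 := by ring
  have h := tendsto_mul_weight_ratio_sub_one_of_two_le (lam := 2 - lam) (by linarith)
  rw [e] at h
  simp_rw [← sph_two_sub lam] at h
  exact h

/-- **THE SHARP FIRST CORRECTION OF THE TRANSFORM, FOR EVERY REAL `λ`**:
`(k − 2)((k − 2) m̂_k(λ)/(2π) − 1) → λ(λ − 2)/2` as `k → ∞`, i.e.
`m̂_k(λ) = (2π/(k − 2))(1 + λ(λ − 2)/(2(k − 2)) + o(1/k))`. -/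
theorem tendsto_mul_weight_ratio_sub_one (lam : ℝ) :
    Tendsto (fun k : ℝ => (k - 2)
        * ((k - 2) * (∫ g, (1 - ‖orbit g‖ ^ 2) ^ (k / 2) * sph lam g ∂(nu haarCircle)) / (2 * π) - 1))
      atTop (𝓝 (lam * (lam - 2) / 2)) := by
  rcases le_or_gt lam 0 with h0 | h0
  · exact tendsto_mul_weight_ratio_sub_one_of_nonpos h0
  rcases le_or_gt 2 lam with h2 | h2
  · exact tendsto_mul_weight_ratio_sub_one_of_two_le h2
  have h := (tendsto_mul_one_sub_weight_ratio h0.le h2.le).neg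
  rw [show -(lam * (2 - lam) / 2) = lam * (lam - 2) / 2 by ring] at h
  refine h.congr' (Filter.Eventually.of_forall fun k => ?_)
  ring

end measure

end Summit.Ventures.HodgeRepro2.T5SU11JacobiPhaseLowerOutside
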